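import Summits.CriticalPhenomena.CardyFormulaZ2.Theses.CardySusyWard
import Summits.CriticalPhenomena.CardyFormulaZ2.Theorems.CardySusyWardDiscretisationFamilyExistsAssemblyA
import Summits.CriticalPhenomena.CardyFormulaZ2.Theorems.CardySelfRefinementLagHandOffDiscretisableLabelling
import HarnessLib

/-!
# `DiscretisationFamilyExists` (stmt-CriticalPhenomena-9644) — every Dobrushin domain carries a discretisation family

Route `CardySusyWard` (decl shared with `CardyComplexCone`, `CardySublatticeCoherence`), sub-problem
`CriticalPhenomena/CardyFormulaZ2`.  PROOF: for every tolerance `η > 0` and all small meshes the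
discrete boundary of the canonical domain `⟨D.carrier, δ, ∅, ∅⟩` is labelled by the two Newman
sides of a cross-cut built from two legs at the marked points (`eventually_labelling`, the
`…DiscretisationFamilyExists*` helper files); a diagonal choice of the tolerance `ε δ → 0`
(the infimum trick) makes the labelling hypotheses of the crosscut dictionary
`zdDiscretisationFamily_of_labelling` hold, which produces a `ZdDiscretisationFamily`; its fields
are the conjuncts of the item.
-/

noncomputable section

open Set Metric Filter Topology
open Literature.Probability.LatticeModels Literature.Probability.Percolation
  Literature.Probability.LatticeModels.DiscreteDobrushin Literature.Probability.RandomPlanarGeometry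
  Summit.CriticalPhenomena.CardyFormulaZ2.Theorems.DiscretisationFamilyExists
  Summit.CriticalPhenomena.CardyFormulaZ2.Cruxes.LagHandOff.CrosscutDictionary

namespace Summit.CriticalPhenomena.CardyFormulaZ2.Theorems

/-- **The infimum trick.** If a property of `(δ, η)` that is upward closed in nothing at all holds,
for every `η > 0`, at all small `δ > 0`, then there is a choice `ε δ → 0⁺` with the property at
`(δ, ε δ)` for all small `δ`. [folklore] -/
theorem exists_tendsto_of_forall_eventually {P : ℝ → ℝ → Prop}
    (h : ∀ η : ℝ, 0 < η → ∀ᶠ δ in 𝓝[>] (0 : ℝ), P δ η) :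
    ∃ ε : ℝ → ℝ, Tendsto ε (𝓝[>] 0) (𝓝 0) ∧ ∀ᶠ δ in 𝓝[>] (0 : ℝ), 0 < ε δ ∧ P δ (ε δ) := by
  classical
  set G : ℝ → Set ℝ := fun δ => {η | 0 < η ∧ P δ η} with hG
  have hbdd : ∀ δ, BddBelow (G δ) := fun δ => ⟨0, fun η hη => hη.1.le⟩
  set ε : ℝ → ℝ := fun δ => if hx : ∃ η, η ∈ G δ ∧ η < sInf (G δ) + δ then Classical.choose hx else 1 with hε
  have hmem : ∀ η : ℝ, 0 < η → ∀ᶠ δ in 𝓝[>] (0 : ℝ), η ∈ G δ := fun η hη =>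
    (h η hη).mono fun δ hδ => ⟨hη, hδ⟩
  have hpos : ∀ᶠ δ in 𝓝[>] (0 : ℝ), 0 < δ := self_mem_nhdsWithin
  -- the choice is made, eventually
  have hchoice : ∀ᶠ δ in 𝓝[>] (0 : ℝ), ε δ ∈ G δ ∧ ε δ < sInf (G δ) + δ := by
    filter_upwards [hmem 1 one_pos, hpos] with δ h1 hδ
    have hx : ∃ η, η ∈ G δ ∧ η < sInf (G δ) + δ := by
      obtain ⟨η, hη, hlt⟩ := exists_lt_of_csInf_lt ⟨1, h1⟩ (lt_add_of_pos_right _ hδ)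
      exact ⟨η, hη, hlt⟩
    have : ε δ = Classical.choose hx := by rw [hε]; exact dif_pos hx
    rw [this]
    exact Classical.choose_spec hx
  refine ⟨ε, ?_, hchoice.mono fun δ hδ => ⟨hδ.1.1, hδ.1.2⟩⟩
  rw [Metric.tendsto_nhds]
  intro e he
  filter_upwards [hchoice, hmem (e / 2) (by positivity), Ioo_mem_nhdsGT (show (0 : ℝ) < e / 2 by positivity)]
    with δ hc h2 hδ
  have hinf : sInf (G δ) ≤ e / 2 := csInf_le (hbdd δ) h2
  rw [Real.dist_eq, sub_zero, abs_of_pos hc.1.1]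
  linarith [hc.2, hδ.2]

/-- **`DiscretisationFamilyExists`**: every Dobrushin domain carries a `ℤ²` discretisation family.
[folklore] -/
theorem DiscretisationFamilyExists_proof :
    Summit.CriticalPhenomena.CardyFormulaZ2.Theses.CardySusyWard.DiscretisationFamilyExists := by
  unfold Summit.CriticalPhenomena.CardyFormulaZ2.Theses.CardySusyWard.DiscretisationFamilyExists
  intro D
  classical
  -- the labelling property at tolerance `η`
  set P : ℝ → ℝ → Prop := fun δ η => ∃ SA SB : Set (Site 2),
      (SA ∪ SB = (⟨D.carrier, δ, ∅, ∅⟩ : DiscreteDobrushin).zdBoundary ∧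
      Disjoint SA SB ∧ SA.Nonempty ∧ SB.Nonempty ∧
      (∀ y ∈ SA, ¬ Metric.closedBall (meshPoint δ y)
          (Metric.infDist (meshPoint δ y) (frontier D.carrier)) ⊆
        ⋃ x ∈ SB, Metric.closedBall (meshPoint δ x)
          (Metric.infDist (meshPoint δ x) (frontier D.carrier))) ∧
      (∀ x ∈ SB, ¬ Metric.closedBall (meshPoint δ x)
          (Metric.infDist (meshPoint δ x) (frontier D.carrier)) ⊆
        ⋃ y ∈ SA, Metric.closedBall (meshPoint δ y)
          (Metric.infDist (meshPoint δ y) (frontier D.carrier))) ∧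
      (∀ y ∈ SA, Metric.infDist (meshPoint δ y) (D.arc 0) ≤ η) ∧
      (∀ x ∈ SB, Metric.infDist (meshPoint δ x) (D.arc 1) ≤ η) ∧
      {e | e ∈ (discreteDomainGraph D.carrier δ).edgeSet ∧ (∃ x ∈ e, x ∈ SA) ∧
        ∃ y ∈ e, y ∈ SB}.ncard = 2 ∧
      ∀ e ∈ (discreteDomainGraph D.carrier δ).edgeSet, (∃ x ∈ e, x ∈ SA) → (∃ y ∈ e, y ∈ SB) →
        ∃! f, (⟨D.carrier, δ, ∅, ∅⟩ : DiscreteDobrushin).IsInnerFace f ∧ ∀ x ∈ e, IsCorner x f) ∧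
      Metric.hausdorffEDist (medialPoint δ ''
        {e | e ∈ (discreteDomainGraph D.carrier δ).edgeSet ∧ (∃ x ∈ e, x ∈ SA) ∧
          ∃ y ∈ e, y ∈ SB}) {D.pt 0, D.pt 1} ≤ ENNReal.ofReal η with hP
  have hev : ∀ η : ℝ, 0 < η → ∀ᶠ δ in 𝓝[>] (0 : ℝ), P δ η := fun η hη => eventually_labelling D hη
  obtain ⟨ε, hε, hgood⟩ := exists_tendsto_of_forall_eventually hev
  -- the labels
  set SA : ℝ → Set (Site 2) := fun δ => if hx : P δ (ε δ) then Classical.choose hx else ∅ with hSA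
  set SB : ℝ → Set (Site 2) := fun δ =>
    if hx : P δ (ε δ) then Classical.choose (Classical.choose_spec hx) else ∅ with hSB
  have hspec : ∀ δ (hx : P δ (ε δ)), SA δ = Classical.choose hx ∧ SB δ = Classical.choose (Classical.choose_spec hx) :=
    fun δ hx => ⟨by rw [hSA]; exact dif_pos hx, by rw [hSB]; exact dif_pos hx⟩
  have hlab' : ∀ᶠ δ in 𝓝[>] (0 : ℝ),
      (SA δ ∪ SB δ = (⟨D.carrier, δ, ∅, ∅⟩ : DiscreteDobrushin).zdBoundary ∧
      Disjoint (SA δ) (SB δ) ∧ (SA δ).Nonempty ∧ (SB δ).Nonempty ∧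
      (∀ y ∈ SA δ, ¬ Metric.closedBall (meshPoint δ y)
          (Metric.infDist (meshPoint δ y) (frontier D.carrier)) ⊆
        ⋃ x ∈ SB δ, Metric.closedBall (meshPoint δ x)
          (Metric.infDist (meshPoint δ x) (frontier D.carrier))) ∧
      (∀ x ∈ SB δ, ¬ Metric.closedBall (meshPoint δ x)
          (Metric.infDist (meshPoint δ x) (frontier D.carrier)) ⊆
        ⋃ y ∈ SA δ, Metric.closedBall (meshPoint δ y)
          (Metric.infDist (meshPoint δ y) (frontier D.carrier))) ∧
      (∀ y ∈ SA δ, Metric.infDist (meshPoint δ y) (D.arc 0) ≤ ε δ) ∧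
      (∀ x ∈ SB δ, Metric.infDist (meshPoint δ x) (D.arc 1) ≤ ε δ) ∧
      {e | e ∈ (discreteDomainGraph D.carrier δ).edgeSet ∧ (∃ x ∈ e, x ∈ SA δ) ∧
        ∃ y ∈ e, y ∈ SB δ}.ncard = 2 ∧
      ∀ e ∈ (discreteDomainGraph D.carrier δ).edgeSet, (∃ x ∈ e, x ∈ SA δ) → (∃ y ∈ e, y ∈ SB δ) →
        ∃! f, (⟨D.carrier, δ, ∅, ∅⟩ : DiscreteDobrushin).IsInnerFace f ∧ ∀ x ∈ e, IsCorner x f) ∧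
      Metric.hausdorffEDist (medialPoint δ ''
        {e | e ∈ (discreteDomainGraph D.carrier δ).edgeSet ∧ (∃ x ∈ e, x ∈ SA δ) ∧
          ∃ y ∈ e, y ∈ SB δ}) {D.pt 0, D.pt 1} ≤ ENNReal.ofReal (ε δ) := by
    filter_upwards [hgood] with δ hδ
    obtain ⟨-, hx⟩ := hδ
    obtain ⟨h1, h2⟩ := hspec δ hx
    rw [h1, h2]
    exact Classical.choose_spec (Classical.choose_spec hx)
  -- the discretisation family
  obtain ⟨E, hE⟩ := zdDiscretisationFamily_of_labelling D SA SB ε hε (hlab'.mono fun δ hδ => hδ.1) (by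
    have h0 : Tendsto (fun δ : ℝ => ENNReal.ofReal (ε δ)) (𝓝[>] 0) (𝓝 0) := by
      rw [← ENNReal.ofReal_zero]; exact ENNReal.tendsto_ofReal hε
    exact tendsto_of_tendsto_of_tendsto_of_le_of_le' tendsto_const_nhds h0
      (Eventually.of_forall fun δ => zero_le) (hlab'.mono fun δ hδ => hδ.2))
  exact ⟨E, hE.Ω_eq, hE.δ_eq, hE.tendsto_arcA, hE.tendsto_arcB, hE.tendsto_zdABEdges, hE.eventually_isZdAdmissible⟩

end Summit.CriticalPhenomena.CardyFormulaZ2.Theorems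

end
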